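import Literature.AlgebraicGeometry.Motives.AbelianVarietyProofs
import HarnessLib

/-!
# The pieces of a smooth morphism on which it has a fixed relative dimension

Area `Literature/AlgebraicGeometry/Motives`. A smooth morphism of schemes `f : X ⟶ Y` (Mathlib
`AlgebraicGeometry.Smooth`: locally standard smooth of SOME relative dimension) need not have
constant relative dimension — its fibres may have components of different dimensions. This file
decomposes the source into the open subschemes `X_d` (`d : ℕ`) on which `f` is smooth of relative
dimension `d`:

* `exists_relativeDimensionPieces` — there are opens `piece d ⊆ X` with (i) `piece d ↪ X → Y`
  smooth of relative dimension `d` (Mathlib `SmoothOfRelativeDimension`); (ii) the `piece d` cover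
  `X`; (iii) a point lies in at most one `piece d` — on a non-empty scheme the relative dimension of
  a morphism smooth of relative dimension `d` is well defined (the rank of `Ω` on a chart; the tree's
  `AbelianVarietyProofs.eq_of_smoothOfRelativeDimension`); (iv) hence every `piece d` is also
  CLOSED, i.e. `X` is the disjoint union of the open and closed subschemes `X_d`.

This is Görtz–Wedhorn I, Prop. 6.15 (1) / Thm. 6.28: the relative dimension of a smooth morphism
is a locally constant function on the source. It is the relative version of the tree's
`exists_smoothPieces` (the case `Y = Spec k`) and is used to apply Deligne's invariant cycle
theorem — whose hard Lefschetz input needs fibres of one fixed dimension — piece by piece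
(`Motives.Voisin2003_invariantCycles`). Everything is proved; no definition, no named fact.

## References

* U. Görtz, T. Wedhorn, *Algebraic Geometry I*, 2nd ed. (2020), Def. 6.14, Prop. 6.15 (1),
  Thm. 6.28. [GortzWedhorn2020]
-/

noncomputable section

open CategoryTheory AlgebraicGeometry TopologicalSpace

universe u

namespace Literature.AlgebraicGeometry.Motives

section Pieces

variable {X Y : Scheme.{u}} (f : X ⟶ Y)

/-- On a non-empty open `V` contained in opens `W`, `W'` over which `f` is smooth of relative
dimensions `d` and `d'`, the two dimensions agree. [cite: GortzWedhorn2020, Prop. 6.15 (1)] -/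
theorem eq_of_smoothOfRelativeDimension_ι_comp {d d' : ℕ} {W W' : X.Opens}
    (hW : SmoothOfRelativeDimension d (W.ι ≫ f)) (hW' : SmoothOfRelativeDimension d' (W'.ι ≫ f))
    {x : X} (hx : x ∈ W) (hx' : x ∈ W') : d = d' := by
  haveI : Nonempty ((W ⊓ W' : X.Opens) : Scheme.{u}) := ⟨⟨x, hx, hx'⟩⟩
  have h₁ : SmoothOfRelativeDimension d ((W ⊓ W').ι ≫ f) := by
    rw [← X.homOfLE_ι (inf_le_left : W ⊓ W' ≤ W), Category.assoc]
    exact IsZariskiLocalAtSource.comp hW _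
  have h₂ : SmoothOfRelativeDimension d' ((W ⊓ W').ι ≫ f) := by
    rw [← X.homOfLE_ι (inf_le_right : W ⊓ W' ≤ W'), Category.assoc]
    exact IsZariskiLocalAtSource.comp hW' _
  exact AbelianVarietyProofs.eq_of_smoothOfRelativeDimension _ h₁ h₂

/-- **The pieces of a smooth morphism of a fixed relative dimension** (Görtz–Wedhorn I,
Prop. 6.15 (1) / Thm. 6.28: the relative dimension of a smooth morphism is locally constant). For
`f : X ⟶ Y` smooth there are opens `piece d ⊆ X`, `d : ℕ` — the unions of the opens `W` with
`W ↪ X → Y` smooth of relative dimension `d` — such that: (i) `piece d ↪ X → Y` is smooth of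
relative dimension `d`; (ii) the `piece d` cover `X`; (iii) a point of `X` lies in at most one
`piece d`; (iv) every `piece d` is closed (its complement is the union of the other pieces), so that
`X = ∐_d piece d` as schemes. [cite: GortzWedhorn2020, Prop. 6.15 (1) and Thm. 6.28] -/
theorem exists_relativeDimensionPieces [Smooth f] :
    ∃ piece : ℕ → X.Opens,
      (∀ d, SmoothOfRelativeDimension d ((piece d).ι ≫ f)) ∧
      (∀ x : X, ∃ d, x ∈ piece d) ∧
      (∀ (d d' : ℕ) (x : X), x ∈ piece d → x ∈ piece d' → d = d') ∧
      (∀ d, IsClosed ((piece d : X.Opens) : Set X)) := by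
  classical
  -- the opens over which `f` is smooth of relative dimension `d`
  let gen : ℕ → Set X.Opens := fun d ↦ {W | SmoothOfRelativeDimension d (W.ι ≫ f)}
  let piece : ℕ → X.Opens := fun d ↦ ⨆ W : gen d, (W : X.Opens)
  have hmem : ∀ {d : ℕ} {x : X}, x ∈ piece d ↔ ∃ W ∈ gen d, x ∈ W := by
    intro d x
    simp only [piece, Opens.mem_iSup, Subtype.exists, exists_prop]
  have hle : ∀ {d : ℕ} {W : X.Opens}, W ∈ gen d → W ≤ piece d :=
    fun {d W} hW ↦ le_iSup (fun W : gen d ↦ (W : X.Opens)) ⟨W, hW⟩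
  -- (iii) uniqueness, at every point
  have huniq : ∀ (d d' : ℕ) (x : X), x ∈ piece d → x ∈ piece d' → d = d' := by
    intro d d' x hx hx'
    obtain ⟨W, hW, hxW⟩ := hmem.mp hx
    obtain ⟨W', hW', hxW'⟩ := hmem.mp hx'
    exact eq_of_smoothOfRelativeDimension_ι_comp f hW hW' hxW hxW'
  -- (ii) the pieces cover
  have hcov : ∀ x : X, ∃ d, x ∈ piece d := fun x ↦ by
    obtain ⟨V, d, hxV, hV⟩ := exists_opens_smoothOfRelativeDimension_of_smooth f x
    exact ⟨d, hmem.mpr ⟨V, hV, hxV⟩⟩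
  refine ⟨piece, fun d ↦ ?_, hcov, huniq, fun d ↦ ?_⟩
  · -- (i) `piece d ↪ X → Y` is smooth of relative dimension `d`: local on the source
    refine IsZariskiLocalAtSource.of_iSup_eq_top (P := @SmoothOfRelativeDimension d)
      (fun W : gen d ↦ (piece d).ι ⁻¹ᵁ (W : X.Opens)) ?_ fun W ↦ ?_
    · rw [eq_top_iff]
      rintro x -
      obtain ⟨W, hW, hxW⟩ := hmem.mp (show (piece d).ι x ∈ piece d from x.2)
      exact Opens.mem_iSup.mpr ⟨⟨W, hW⟩, hxW⟩
    · -- the open `(piece d).ι ⁻¹ W` of `piece d` is `W`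
      set i : ((piece d).ι ⁻¹ᵁ (W : X.Opens) : Scheme.{u}) ⟶ X :=
        ((piece d).ι ⁻¹ᵁ (W : X.Opens)).ι ≫ (piece d).ι with hi
      haveI : IsOpenImmersion i := by rw [hi]; infer_instance
      have hr : Set.range i = Set.range (W : X.Opens).ι := by
        rw [hi, Scheme.Opens.range_ι, Scheme.Hom.comp_base, TopCat.coe_comp, Set.range_comp,
          Scheme.Opens.range_ι]
        change (piece d).ι '' ((piece d).ι ⁻¹' ((W : X.Opens) : Set X)) = _
        rw [Set.image_preimage_eq_inter_range, Scheme.Opens.range_ι]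
        exact Set.inter_eq_left.mpr (hle W.2)
      have hfac : ((piece d).ι ⁻¹ᵁ (W : X.Opens)).ι ≫ (piece d).ι ≫ f =
          (IsOpenImmersion.isoOfRangeEq i (W : X.Opens).ι hr).hom ≫ (W : X.Opens).ι ≫ f := by
        rw [← Category.assoc, ← hi, IsOpenImmersion.isoOfRangeEq_hom_fac_assoc]
      rw [hfac, MorphismProperty.cancel_left_of_respectsIso (P := @SmoothOfRelativeDimension d)]
      exact W.2
  · -- (iv) the complement of `piece d` is the union of the other pieces
    have hc : ((piece d : X.Opens) : Set X)ᶜ = ⋃ d' ∈ {d' : ℕ | d' ≠ d}, ((piece d' : X.Opens) : Set X) := by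
      ext x
      simp only [Set.mem_compl_iff, SetLike.mem_coe, Set.mem_iUnion, Set.mem_setOf_eq, exists_prop]
      constructor
      · intro hx
        obtain ⟨d', hd'⟩ := hcov x
        exact ⟨d', fun h ↦ hx (h ▸ hd'), hd'⟩
      · rintro ⟨d', hne, hd'⟩ hd
        exact hne (huniq d' d x hd' hd)
    rw [← isOpen_compl_iff, hc]
    exact isOpen_biUnion fun d' _ ↦ (piece d').isOpen

end Pieces

end Literature.AlgebraicGeometry.Motives

end
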